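import Summits.FinalStateConjecture.FinalStateConjecture.Theorems.SwallowTheDatumUniversalWitnessFamilyRegionOneAssembly
import Literature.Geometry.Lorentzian.CauchyDevelopmentGlobalHyperbolicityProofs
import Literature.Geometry.Lorentzian.ConvergenceTransport
import Literature.Geometry.Lorentzian.CausalFutureCompactSet
import Literature.Geometry.Lorentzian.CausalityOpennessProofs
import Literature.Geometry.Lorentzian.CausalityClosedProofs

/-!
# Stub `stub_farSlabNoEscape` (line far-field-surgery, sheet burial): no accumulation of the far
# flat slabs of region I at the Cauchy horizon

Region I of Schwarzschild, `Kerr.spacetime M 0 (2M)` (ingoing Kerr–Schild coordinates, carrier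
`Kerr.region 0 (2M) = {‖x̃‖ > 2M}`), is embedded by a smooth, isometric, time-oriented open embedding
`χ` into a Cauchy development `𝒟` over the isotropic sheet (`χ ∘ ψ = ι ∘ Φ'`, `range ψ = {t = 0}`
the static slice).  The flat chart is `Φ y = outMap M y = y + 2 torH(‖ỹ‖) e₀`.  CLAIM
(`stub_farSlabNoEscape`): for `τ' > T₀ + 1` every limit `z` in `𝒟` of points `χ(Φ yₙ)` with
`τ' ≤ yₙ⁰`, `excision M yₙ⁰ + 1 ≤ ‖ỹₙ‖` lies in `range χ`, granted PROPERNESS of `Φ'` at infinity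
and NO FUTURE ACCUMULATION of static world-lines of bounded radius (both hypotheses).

Proof.  (1) The radii `‖ỹₙ‖` are eventually bounded: pick `z⁺` with `z ∈ I⁻(z⁺)`
(`exists_mem_nhds_mem_chronologicalFuture` for the reversed orientation); `I⁻(z⁺)` is open, so
eventually `χ(Φ yₙ) ∈ I⁻(z⁺) ⊆ J⁻(z⁺)`; the static-slice foot point `ψ wₙ = Φ yₙ − t e₀` lies in
`J⁻(Φ yₙ)` (`mem_causalPast_vert`), hence `ι(Φ' wₙ) = χ(ψ wₙ) ∈ J⁻(z⁺) ∩ J⁺(ι X)`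
(`image_causalPast_subset`, transitivity `J⁻ J⁻ = J⁻`), a compact set
(`CauchyDevelopment.isCompact_causalPast_inter_causalFuture_range`) whose preimage under the closed
embedding `ι` is compact; properness bounds `‖wₙ‖ ≤ R'`, and the areal radius is
`‖ỹₙ‖ = ‖wₙ‖(1 + M/2‖wₙ‖)² ≤ 4‖wₙ‖`.  (2) If `yₙ⁰ → ∞`, the static times
`t(Φ yₙ) = yₙ⁰ + torH ‖ỹₙ‖ ≥ yₙ⁰` tend to `∞` at radii in `[excision τ' + 1, 4R']`, excluded by the
no-accumulation hypothesis.  (3) Otherwise `yₙ⁰ < B` frequently, so `Φ yₙ` lies frequently in the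
compact coordinate box `{‖x̃‖ ∈ [excision τ' + 1, 4R'], x⁰ ∈ [τ', B + 2 torH(4R')]}` of region I; a
subsequence converges there and `z = χ(lim)` by continuity of `χ` and uniqueness of limits.

References: O'Neill 1983, Ch. 14 (causality relations, Lemma 14.22, 14.40); Hawking–Ellis 1973,
§6.5–6.6 (Cauchy developments, Prop. 6.6.6).
-/

set_option linter.dupNamespace false

noncomputable section

namespace Summit.FinalStateConjecture.FinalStateConjecture.Theorems.StarvedNecks.SheetBurial

open scoped Manifold ContDiff Topology
open Set Filter Function Literature.Geometry.Lorentzian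
open Summit.FinalStateConjecture.FinalStateConjecture.Theorems.SwallowTheDatum.UniversalWitnessFamily

/-! ## Elementary helpers -/

/-- Pythagoras for the time/space splitting of `E4`, as a bound: `‖x‖ ≤ |x⁰| + ‖x̃‖`. -/
private theorem norm_le_abs_add_spatialNorm (x : E4) : ‖x‖ ≤ |x 0| + E4.spatialNorm x := by
  have h : ‖x‖ ^ 2 = (x 0) ^ 2 + ‖E4.spatial x‖ ^ 2 := by
    rw [EuclideanSpace.norm_sq_eq, EuclideanSpace.norm_sq_eq, Fin.sum_univ_succ]
    simp [E4.spatial_apply]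
  have h0 : 0 ≤ E4.spatialNorm x := E4.spatialNorm_nonneg x
  refine (pow_le_pow_iff_left₀ (norm_nonneg x) (by positivity) two_ne_zero).1 ?_
  rw [h]
  unfold E4.spatialNorm at h0 ⊢
  nlinarith [abs_nonneg (x 0), sq_abs (x 0)]

/-- The coordinate box `{r₁ ≤ ‖x̃‖ ≤ r₂, a ≤ x⁰ ≤ b}` with `r₁ > 2M` is a compact subset of region I
(closed and bounded in `E4`, contained in `{‖x̃‖ > 2M}`). -/
private theorem isCompact_preimage_box {M : ℝ} (hM : 0 ≤ M) {r₁ : ℝ} (hr₁ : 2 * M < r₁) (r₂ a b : ℝ) :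
    IsCompact ((Subtype.val : Kerr.region 0 (Kerr.rPlus M 0) → E4) ⁻¹'
      {x | r₁ ≤ E4.spatialNorm x ∧ E4.spatialNorm x ≤ r₂ ∧ a ≤ x 0 ∧ x 0 ≤ b}) := by
  have hsN : Continuous E4.spatialNorm := continuous_norm.comp E4.spatial.continuous
  have h0c : Continuous fun x : E4 ↦ x 0 := (contDiff_apply_zero (n := 0)).continuous
  have hclosed : IsClosed {x : E4 | r₁ ≤ E4.spatialNorm x ∧ E4.spatialNorm x ≤ r₂ ∧ a ≤ x 0 ∧ x 0 ≤ b} :=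
    (isClosed_le continuous_const hsN).and <| (isClosed_le hsN continuous_const).and <|
      (isClosed_le continuous_const h0c).and (isClosed_le h0c continuous_const)
  have hbdd : Bornology.IsBounded
      {x : E4 | r₁ ≤ E4.spatialNorm x ∧ E4.spatialNorm x ≤ r₂ ∧ a ≤ x 0 ∧ x 0 ≤ b} := by
    refine (Metric.isBounded_closedBall (x := (0 : E4)) (r := |a| + |b| + |r₂|)).subset ?_
    rintro x ⟨-, h2, h3, h4⟩
    rw [Metric.mem_closedBall, dist_zero_right]
    have h0 : |x 0| ≤ |a| + |b| :=
      abs_le.2 ⟨by linarith [neg_abs_le a, abs_nonneg b], by linarith [le_abs_self b, abs_nonneg a]⟩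
    linarith [norm_le_abs_add_spatialNorm x, le_abs_self r₂]
  refine Topology.IsInducing.subtypeVal.isCompact_preimage'
    (Metric.isCompact_of_isClosed_isBounded hclosed hbdd) ?_
  rintro x ⟨h1, -⟩
  exact ⟨⟨x, (mem_region_iff hM).2 (hr₁.trans_le h1)⟩, rfl⟩

/-- Areal versus isotropic radius: `ρ (1 + M/2ρ)² ≤ 4ρ` for `ρ > M/2 > 0`. -/
private theorem iso_areal_le {M ρ : ℝ} (hM : 0 < M) (hρ : M / 2 < ρ) :
    ρ * (1 + M / (2 * ρ)) ^ 2 ≤ 4 * ρ := by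
  have hρ0 : 0 < ρ := by linarith
  have h1 : M / (2 * ρ) ≤ 1 := by rw [div_le_one (by positivity)]; linarith
  have h2 : 0 ≤ M / (2 * ρ) := by positivity
  have h3 : (1 + M / (2 * ρ)) ^ 2 ≤ 4 := by nlinarith
  calc ρ * (1 + M / (2 * ρ)) ^ 2 ≤ ρ * 4 := mul_le_mul_of_nonneg_left h3 hρ0.le
    _ = 4 * ρ := by ring

/-- **The static-slice foot point.**  Below every event `x` of region I with static time `t(x) ≥ 0`
there is a sheet point `ψ w = x − t(x) e₀ ∈ J⁻(x)` (vertical static orbit), of the same areal radius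
`‖x̃‖ = ‖w‖ (1 + M/2‖w‖)²`. -/
private theorem exists_foot [Kerr.Facts] {M : ℝ} (hM : 0 < M)
    {ψ : Schwarzschild.isotropicExterior M → Kerr.region 0 (Kerr.rPlus M 0)}
    (hψ : ∀ y, (ψ y : E4) =
      E4.ofTimeSpace (2 * M * Real.log (‖(y : E3)‖ * (1 + M / (2 * ‖(y : E3)‖)) ^ 2 / (2 * M) - 1))
        ((1 + M / (2 * ‖(y : E3)‖)) ^ 2 • (y : E3)))
    (x : Kerr.region 0 (Kerr.rPlus M 0)) (hx : 0 ≤ staticTime M x.1) :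
    ∃ w : Schwarzschild.isotropicExterior M,
      ψ w ∈ (Kerr.smoothMetric M 0 (Kerr.rPlus M 0)).causalPast (ksTime hM.le) {x} ∧
      E4.spatialNorm x.1 = ‖(w : E3)‖ * (1 + M / (2 * ‖(w : E3)‖)) ^ 2 := by
  obtain ⟨w, hw⟩ := vert_neg_staticTime_mem_range hM hψ x
  refine ⟨w, ?_, ?_⟩
  · have hJ := mem_causalPast_vert hM (vert x (-staticTime M x.1)) hx
    rw [vert_add, neg_add_cancel, vert_zero] at hJ
    rw [hw]
    exact hJ
  · have h1 : E4.spatialNorm (ψ w).1 = ‖(w : E3)‖ * (1 + M / (2 * ‖(w : E3)‖)) ^ 2 := by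
      rw [hψ w, E4.spatialNorm_ofTimeSpace, norm_isoScale_smul]
    rw [← h1, hw, spatialNorm_vert]

/-- Transitivity of the causal past in a Cauchy development: `a ≤ b ≤ c ⟹ a ≤ c`
(`J⁻(J⁻(c)) = J⁻(c)` on a manifold without boundary). -/
private theorem causalPast_trans {X : Type} [TopologicalSpace X] [ChartedSpace E3 X] [IsManifold (𝓡 3) ∞ X]
    [ConnectedSpace X] {D : InitialDataSet (𝓡 3) X} (𝒟 : CauchyDevelopment D) {a b c : 𝒟.carrier}
    (hab : a ∈ 𝒟.metric.causalPast 𝒟.timeOrientation {b})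
    (hbc : b ∈ 𝒟.metric.causalPast 𝒟.timeOrientation {c}) :
    a ∈ 𝒟.metric.causalPast 𝒟.timeOrientation {c} := by
  have hn2 : (2 : ℕ∞ω) ≤ ∞ := WithTop.coe_le_coe.mpr le_top
  have h : a ∈ 𝒟.metric.causalFuture 𝒟.timeOrientation.reverse
      (𝒟.metric.causalFuture 𝒟.timeOrientation.reverse {c}) :=
    LorentzianMetric.causalFuture_mono (singleton_subset_iff.2 hbc) hab
  rwa [LorentzianMetric.causalFuture_causalFuture_eq hn2] at h

/-! ## The stub -/

/-- **Stub 7 — `stub_farSlabNoEscape` (NO ACCUMULATION OF THE FAR FLAT SLABS OF REGION I AT THE CAUCHY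
HORIZON).**  Flat chart `Φ y = outMap M y` on `U = {x⁰ > T₀ + 1, ‖x̃‖ > excision M x⁰}`; `χ` an isometric
time-oriented open embedding of region I into a Cauchy development `𝒟` over the sheet (`χ ∘ ψ = ι ∘ Φ'`);
PROPERNESS of `Φ'` and NO FUTURE ACCUMULATION as hypotheses.  Then for `τ' > T₀ + 1` every limit in `𝒟`
of points `χ(Φ yₙ)`, `τ' ≤ yₙ⁰`, `excision M yₙ⁰ + 1 ≤ ‖ỹₙ‖`, lies in `range χ`: the radii are eventually
bounded (foot points in the compact `ι⁻¹(J⁻(z⁺) ∩ J⁺(ι X))`, properness), escape to timelike infinity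
is the excluded accumulation, and otherwise a subsequence converges in a compact coordinate box of
region I. [folklore] -/
theorem stub_farSlabNoEscape :
    ∀ [Kerr.Facts] (M : ℝ) (hM : 0 < M) (T₀ : ℝ), 0 ≤ T₀ →
      ∀ (U : TopologicalSpace.Opens E4),
      (∀ x, x ∈ U ↔ T₀ + 1 < x 0 ∧ excision M (x 0) < E4.spatialNorm x) →
      ∀ (Φ : (Minkowski.backgroundOn U).domain → Kerr.region 0 (Kerr.rPlus M 0)),
      (∀ y, (Φ y : E4) = outMap M y) →
      ∀ (X : Type) [TopologicalSpace X] [ChartedSpace E3 X] [IsManifold (𝓡 3) ∞ X]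
        [T2Space X] [SecondCountableTopology X] [ConnectedSpace X]
        (D : InitialDataSet (𝓡 3) X) (𝒟 : CauchyDevelopment D)
        (Φ' : Schwarzschild.isotropicExterior M → X)
        (ψ : Schwarzschild.isotropicExterior M → Kerr.region 0 (Kerr.rPlus M 0)),
        (∀ y, (ψ y : E4) =
          E4.ofTimeSpace (2 * M * Real.log (‖(y : E3)‖ * (1 + M / (2 * ‖(y : E3)‖)) ^ 2 / (2 * M) - 1))
            ((1 + M / (2 * ‖(y : E3)‖)) ^ 2 • (y : E3))) →
        ∀ (χ : (Kerr.spacetime M 0 (Kerr.rPlus M 0) hM.le).carrier → 𝒟.carrier),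
        ContMDiff (𝓡 4) (𝓡 4) ∞ χ → Topology.IsOpenEmbedding χ →
        (Kerr.spacetime M 0 (Kerr.rPlus M 0) hM.le).metric.IsIsometricImmersion
          𝒟.metric.toPseudoRiemannianMetric χ →
        (Kerr.spacetime M 0 (Kerr.rPlus M 0) hM.le).timeOrientation.PreservesTimeOrientation χ
          𝒟.timeOrientation →
        χ ∘ ψ = 𝒟.embed ∘ Φ' →
        (∀ K : Set X, IsCompact K →
          ∃ R' : ℝ, ∀ y : Schwarzschild.isotropicExterior M, R' < ‖(y : E3)‖ → Φ' y ∉ K) →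
        (∀ (p : ℕ → Kerr.region 0 (Kerr.rPlus M 0)) (r₁ r₂ : ℝ), 2 * M < r₁ →
          (∀ n, r₁ ≤ E4.spatialNorm (p n).1 ∧ E4.spatialNorm (p n).1 ≤ r₂) →
          Tendsto (fun n ↦ staticTime M (p n).1) atTop atTop →
          ∀ z : 𝒟.carrier, ¬ Tendsto (fun n ↦ χ (p n)) atTop (𝓝 z)) →
        ∀ τ' : ℝ, T₀ + 1 < τ' →
          closure (χ '' (Φ '' {y | τ' ≤ y.1 0 ∧ excision M (y.1 0) + 1 ≤ E4.spatialNorm y.1})) ⊆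
            Set.range χ := by
  intro _ M hM T₀ hT₀ U _hU Φ hΦ X _ _ _ _ _ _ D 𝒟 Φ' ψ hψ χ hχ hχo hiso hτ hcomm hproper hnoacc τ' hτ'
    z hz
  -- topology of the development: a metrizable manifold
  haveI : LocallyCompactSpace 𝒟.carrier :=
    Manifold.locallyCompact_of_finiteDimensional (M := 𝒟.carrier) (𝓡 4)
  haveI : TopologicalSpace.MetrizableSpace 𝒟.carrier := Manifold.metrizableSpace (𝓡 4) 𝒟.carrier
  have hn2 : (2 : ℕ∞ω) ≤ ∞ := WithTop.coe_le_coe.mpr le_top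
  have hn1 : (1 : ℕ∞ω) ≤ ∞ := le_trans one_le_two hn2
  have hχd : MDifferentiable (𝓡 4) (𝓡 4) χ := hχ.mdifferentiable (by simp)
  have hφ : ∀ q, pullbackBilin (I := 𝓡 4) (I' := 𝓡 4) χ 𝒟.metric.val q =
      (Kerr.spacetime M 0 (Kerr.rPlus M 0) hM.le).metric.val q := hiso.2
  -- a sequence `χ (Φ (y n)) → z` in the far slab
  rw [mem_closure_iff_seq_limit] at hz
  obtain ⟨c, hc, hcz⟩ := hz
  have hc' : ∀ n, ∃ y : (Minkowski.backgroundOn U).domain,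
      (τ' ≤ y.1 0 ∧ excision M (y.1 0) + 1 ≤ E4.spatialNorm y.1) ∧ χ (Φ y) = c n := by
    intro n
    obtain ⟨_, ⟨y, hy, rfl⟩, h⟩ := hc n
    exact ⟨y, hy, h⟩
  choose y hyS hyc using hc'
  have hsc : Tendsto (fun n ↦ χ (Φ (y n))) atTop (𝓝 z) := hcz.congr fun n ↦ (hyc n).symm
  -- coordinates of `Φ (y n)`
  have hτ'0 : 0 < τ' := by linarith
  have h4M : 4 * M < excision M τ' := four_mul_lt_excision hM τ'
  have h2M : 2 * M < excision M τ' + 1 := by linarith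
  have hsr : ∀ n, E4.spatialNorm (Φ (y n)).1 = E4.spatialNorm (y n).1 := fun n ↦ by
    rw [hΦ, spatialNorm_outMap]
  have hs0 : ∀ n, (Φ (y n)).1 0 = (y n).1 0 + 2 * torH M (E4.spatialNorm (y n).1) := fun n ↦ by
    rw [hΦ, outMap_apply_zero]
  have hst : ∀ n, staticTime M (Φ (y n)).1 = (y n).1 0 + torH M (E4.spatialNorm (y n).1) := fun n ↦ by
    rw [hΦ, staticTime_outMap]
  have hr1 : ∀ n, excision M τ' + 1 ≤ E4.spatialNorm (Φ (y n)).1 := fun n ↦ by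
    rw [hsr]
    linarith [excision_le_excision hM hτ'0.le (hyS n).1, (hyS n).2]
  have htor : ∀ n, 0 ≤ torH M (E4.spatialNorm (y n).1) := fun n ↦
    torH_nonneg hM (by linarith [hr1 n, hsr n])
  have hst_ge : ∀ n, (y n).1 0 ≤ staticTime M (Φ (y n)).1 := fun n ↦ by
    rw [hst]; linarith [htor n]
  have hst_nn : ∀ n, 0 ≤ staticTime M (Φ (y n)).1 := fun n ↦ by
    linarith [hst_ge n, (hyS n).1]
  -- (1) the radii are eventually bounded: no escape to spatial infinity
  obtain ⟨zp, -, hzzp⟩ := LorentzianMetric.exists_mem_nhds_mem_chronologicalFuture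
    (g := 𝒟.metric) (τ := 𝒟.timeOrientation.reverse) hn1 (k := z) univ_mem
  have hPopen : IsOpen (𝒟.metric.chronologicalPast 𝒟.timeOrientation {zp}) :=
    LorentzianMetric.isOpen_chronologicalPast_of_boundaryless _ _ _
  have hevP : ∀ᶠ n in atTop, χ (Φ (y n)) ∈ 𝒟.metric.chronologicalPast 𝒟.timeOrientation {zp} :=
    hsc.eventually_mem (hPopen.mem_nhds hzzp)
  have hcl : IsClosed (range 𝒟.embed) :=
    LorentzianMetric.IsCauchyHypersurface.isClosed_holds hn2 𝒟.isCauchyHypersurface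
  have hce : Topology.IsClosedEmbedding 𝒟.embed := ⟨𝒟.isSmoothEmbedding.isEmbedding, hcl⟩
  have hKc : IsCompact (𝒟.embed ⁻¹' (𝒟.metric.causalPast 𝒟.timeOrientation {zp} ∩
      𝒟.metric.causalFuture 𝒟.timeOrientation (range 𝒟.embed))) :=
    hce.isCompact_preimage (𝒟.isCompact_causalPast_inter_causalFuture_range zp)
  obtain ⟨R', hR'⟩ := hproper _ hKc
  have hevR : ∀ᶠ n in atTop, E4.spatialNorm (Φ (y n)).1 ≤ 4 * R' := by
    filter_upwards [hevP] with n hn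
    obtain ⟨w, hwJ, hwr⟩ := exists_foot hM hψ (Φ (y n)) (hst_nn n)
    have h1 : χ (ψ w) ∈ 𝒟.metric.causalPast 𝒟.timeOrientation {χ (Φ (y n))} :=
      LorentzianMetric.causalFuture_mono (image_singleton (f := χ) (a := Φ (y n))).subset
        (LorentzianMetric.image_causalPast_subset hχd hτ hφ {Φ (y n)} (mem_image_of_mem χ hwJ))
    have h2 : χ (Φ (y n)) ∈ 𝒟.metric.causalPast 𝒟.timeOrientation {zp} :=
      LorentzianMetric.chronologicalFuture_subset_causalFuture 𝒟.metric 𝒟.timeOrientation.reverse {zp} hn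
    have h3 := causalPast_trans 𝒟 h1 h2
    have h4 : χ (ψ w) = 𝒟.embed (Φ' w) := by
      have := congrFun hcomm w
      simpa only [comp_apply] using this
    have h5 : 𝒟.embed (Φ' w) ∈ 𝒟.metric.causalPast 𝒟.timeOrientation {zp} ∩
        𝒟.metric.causalFuture 𝒟.timeOrientation (range 𝒟.embed) := by
      rw [← h4]
      exact ⟨h3, LorentzianMetric.subset_causalFuture _ _ _ ⟨Φ' w, h4.symm⟩⟩
    have hwle : ‖(w : E3)‖ ≤ R' := not_lt.1 fun h ↦ hR' w h h5
    have hwpos : M / 2 < ‖(w : E3)‖ := Schwarzschild.mem_isotropicExterior.1 w.2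
    calc E4.spatialNorm (Φ (y n)).1 = ‖(w : E3)‖ * (1 + M / (2 * ‖(w : E3)‖)) ^ 2 := hwr
      _ ≤ 4 * ‖(w : E3)‖ := iso_areal_le hM hwpos
      _ ≤ 4 * R' := by linarith
  -- (2)/(3) dichotomy on the flat times `yₙ⁰`
  by_cases htend : Tendsto (fun n ↦ (y n).1 0) atTop atTop
  · -- escape to timelike infinity at bounded radius: the excluded accumulation
    exfalso
    obtain ⟨N, hN⟩ := eventually_atTop.1 hevR
    refine hnoacc (fun n ↦ Φ (y (n + N))) (excision M τ' + 1) (4 * R') h2M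
      (fun n ↦ ⟨hr1 _, hN _ (Nat.le_add_left N n)⟩) ?_ z (hsc.comp (tendsto_add_atTop_nat N))
    exact tendsto_atTop_mono (fun n ↦ hst_ge (n + N)) (htend.comp (tendsto_add_atTop_nat N))
  · -- bounded flat times frequently: a limit inside a compact coordinate box of region I
    simp only [tendsto_atTop, not_forall, Filter.not_eventually, not_le] at htend
    obtain ⟨B, hB⟩ := htend
    have hCc := isCompact_preimage_box hM.le h2M (4 * R') τ' (B + 2 * torH M (4 * R'))
    have hfreqC : ∃ᶠ n in atTop, Φ (y n) ∈ (Subtype.val : Kerr.region 0 (Kerr.rPlus M 0) → E4) ⁻¹'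
        {x | excision M τ' + 1 ≤ E4.spatialNorm x ∧ E4.spatialNorm x ≤ 4 * R' ∧ τ' ≤ x 0 ∧
          x 0 ≤ B + 2 * torH M (4 * R')} := by
      refine (hB.and_eventually hevR).mono fun n hn ↦ ?_
      obtain ⟨hnB, hnR⟩ := hn
      have hrn : 2 * M < E4.spatialNorm (y n).1 := by linarith [hr1 n, hsr n]
      have hmono : torH M (E4.spatialNorm (y n).1) ≤ torH M (4 * R') :=
        torH_le_torH hM hrn ((hsr n).symm.le.trans hnR)
      refine ⟨hr1 n, hnR, ?_, ?_⟩
      · rw [hs0]; linarith [htor n, (hyS n).1]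
      · rw [hs0]; linarith
    obtain ⟨a, -, φ, hφm, hlim⟩ := hCc.tendsto_subseq' hfreqC
    have h1 : Tendsto (fun n ↦ χ (Φ (y (φ n)))) atTop (𝓝 (χ a)) := (hχo.continuous.tendsto a).comp hlim
    have h2 : Tendsto (fun n ↦ χ (Φ (y (φ n)))) atTop (𝓝 z) := hsc.comp hφm.tendsto_atTop
    exact ⟨a, tendsto_nhds_unique h1 h2⟩

end Summit.FinalStateConjecture.FinalStateConjecture.Theorems.StarvedNecks.SheetBurial

end
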